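import Mathlib.Analysis.Asymptotics.SuperpolynomialDecay
import Mathlib.Analysis.SpecialFunctions.Pow.Real
import Literature.MathematicalPhysics.QuantumLattice.LTQO
import HarnessLib

/-!
# Decay calculus for the Michalakis–Zwolak bookkeeping (power bounds, tails, convolutions)

Top-down layer (seat B) of the formalisation of the Michalakis–Zwolak stability theorem
(hubbard.S19, `Literature.MathematicalPhysics.QuantumLattice.michalakis_zwolak`). The constants of
Michalakis–Zwolak, CMP **322** (2013) 277 = arXiv:1109.1588 (Lemma 3: `‖Δ_u‖`; Lemma 4: the decay
`w(r)`; Proposition 2: `c = C_d Σ_k r_k^d ŵ(r_k)/γ(r_k)`; §7: "`L^d max{Δ₀(L*), f₀(L*)}` decays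
rapidly") are all obtained from *superpolynomially decaying* rate functions (`HasFastDecay`, i.e.
Mathlib's `Asymptotics.SuperpolynomialDecay` along `atTop` in the parameter `n ↦ (n : ℝ)`) by
finite sums, tails, convolutions, square roots and polynomial weights. This file provides that
calculus in the explicit form of **power bounds** `|f n| ≤ C / (n + 1)^p`:

* `HasFastDecay.exists_pow_bound` — every fast-decaying sequence admits, for every `p`, a
  constant `C ≥ 0` with `|f n| ≤ C / (n + 1)^p` for *all* `n`;
* `sum_range_le_of_sq_bound` — `Σ_{i<R} φ i ≤ 2C` when `0 ≤ φ i ≤ C/(i+1)²`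
  (`Σ 1/(i+1)² ≤ 2` by telescoping);
* `sum_filter_lt_le_of_pow_bound` — tails: `Σ_{i<R, k<i} φ i ≤ 2C/(k+1)^p` when
  `φ i ≤ C/(i+1)^{p+2}`;
* `sum_mul_sub_le_of_pow_bound` — convolutions: `Σ_{i ≤ M} f i g (M − i) ≤ A B/(M+1)^p` when
  `f i ≤ A/(i+1)^{p+1}`, `g i ≤ B/(i+1)^{p+1}` (`(i+1)(M−i+1) ≥ M+1`);
* `sqrt_le_of_pow_bound` — `√(a φ k) ≤ √(a C)/(k+1)^p` when `φ k ≤ C/(k+1)^{2p}`;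
* the half-index reparametrisation `1/(j − j/2 + 1)^p ≤ 2^p/(j+1)^p`.

No definitions, no named facts (theorems only).
-/

noncomputable section

open Finset Filter Asymptotics
open scoped Topology

namespace Literature.MathematicalPhysics.QuantumLattice

/-! ### From superpolynomial decay to power bounds -/

/-- **Power bounds from fast decay.** A superpolynomially decaying sequence satisfies, for every
`p`, `|f n| ≤ C / (n + 1)^p` for all `n`, with some `C ≥ 0` (Mathlib's
`superpolynomialDecay_iff_isBigO` with exponent `−p` for large `n`, and the finitely many small
`n` absorbed into the constant). [folklore] -/
theorem HasFastDecay.exists_pow_bound {f : ℕ → ℝ} (hf : HasFastDecay f) (p : ℕ) :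
    ∃ C : ℝ, 0 ≤ C ∧ ∀ n : ℕ, |f n| ≤ C / ((n : ℝ) + 1) ^ p := by
  -- large `n`: `|f n| ≤ c / n^p ≤ c 2^p / (n+1)^p`
  have hk : Tendsto (fun n : ℕ => (n : ℝ)) atTop atTop := tendsto_natCast_atTop_atTop
  have hO := (superpolynomialDecay_iff_isBigO f hk).1 hf (-(p : ℤ))
  obtain ⟨c, hc⟩ := hO.bound
  rw [eventually_atTop] at hc
  obtain ⟨N, hN⟩ := hc
  -- the constant
  set C₁ : ℝ := |c| * 2 ^ p with hC₁
  set C₂ : ℝ := ∑ n ∈ range (N + 1), |f n| * ((n : ℝ) + 1) ^ p with hC₂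
  have hC₂0 : 0 ≤ C₂ := sum_nonneg fun n _ => by positivity
  refine ⟨C₁ + C₂, by positivity, fun n => ?_⟩
  have hn1 : (0 : ℝ) < (n : ℝ) + 1 := by positivity
  rw [le_div_iff₀ (pow_pos hn1 p)]
  rcases lt_or_ge n (N + 1) with hlt | hge
  · -- small `n`: a term of `C₂`
    have hterm : |f n| * ((n : ℝ) + 1) ^ p ≤ C₂ := by
      rw [hC₂]
      exact single_le_sum (f := fun n => |f n| * ((n : ℝ) + 1) ^ p)
        (fun i _ => by positivity) (mem_range.mpr hlt)
    have : 0 ≤ C₁ := by positivity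
    linarith
  · have hnN : N ≤ n := by omega
    have hn0 : 1 ≤ n := by omega
    have hnpos : (0 : ℝ) < n := by exact_mod_cast hn0
    have h1 := hN n hnN
    simp only [Real.norm_eq_abs, zpow_neg, zpow_natCast] at h1
    -- `|f n| ≤ c |(n^p)⁻¹| = c / n^p`
    have h2 : |f n| ≤ |c| / (n : ℝ) ^ p := by
      refine h1.trans ?_
      rw [abs_inv, abs_of_pos (pow_pos hnpos p), div_eq_mul_inv]
      exact mul_le_mul_of_nonneg_right (le_abs_self c) (by positivity)
    have hn1' : (1 : ℝ) ≤ n := by exact_mod_cast hn0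
    have h3 : ((n : ℝ) + 1) ^ p ≤ 2 ^ p * (n : ℝ) ^ p := by
      rw [← mul_pow]
      exact pow_le_pow_left₀ hn1.le (by linarith) p
    calc |f n| * ((n : ℝ) + 1) ^ p ≤ |c| / (n : ℝ) ^ p * (2 ^ p * (n : ℝ) ^ p) :=
          mul_le_mul h2 h3 (by positivity) (by positivity)
      _ = C₁ := by rw [hC₁]; field_simp
      _ ≤ C₁ + C₂ := by linarith

/-- Power bounds for a fast-decaying sequence, without absolute values. [folklore] -/
theorem HasFastDecay.exists_pow_bound' {f : ℕ → ℝ} (hf : HasFastDecay f) (p : ℕ) :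
    ∃ C : ℝ, 0 ≤ C ∧ ∀ n : ℕ, f n ≤ C / ((n : ℝ) + 1) ^ p := by
  obtain ⟨C, hC, h⟩ := hf.exists_pow_bound p
  exact ⟨C, hC, fun n => (le_abs_self _).trans (h n)⟩

/-! ### Elementary sums -/

/-- `Σ_{i<R} 1/(i+1)² ≤ 2` (`1/(i+1)² ≤ 1/(i+½) − 1/(i+3/2)`, telescoping to `2 − 1/(R+½)`).
[folklore] -/
theorem sum_range_one_div_sq_le_two (R : ℕ) :
    ∑ i ∈ range R, 1 / ((i : ℝ) + 1) ^ 2 ≤ 2 := by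
  have key : ∀ i : ℕ, 1 / ((i : ℝ) + 1) ^ 2 ≤ 1 / ((i : ℝ) + 1 / 2) - 1 / ((i : ℝ) + 3 / 2) := by
    intro i
    have h0 : (0 : ℝ) ≤ i := by positivity
    have h2 : (0 : ℝ) < (i : ℝ) + 1 / 2 := by positivity
    have h3 : (0 : ℝ) < (i : ℝ) + 3 / 2 := by positivity
    rw [div_sub_div _ _ h2.ne' h3.ne', div_le_div_iff₀ (by positivity) (by positivity)]
    nlinarith
  have htel : ∀ n : ℕ, ∑ i ∈ range n, (1 / ((i : ℝ) + 1 / 2) - 1 / ((i : ℝ) + 3 / 2)) =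
      2 - 1 / ((n : ℝ) + 1 / 2) := by
    intro n
    induction n with
    | zero => norm_num
    | succ n ih =>
      rw [sum_range_succ, ih]
      push_cast
      ring
  calc ∑ i ∈ range R, 1 / ((i : ℝ) + 1) ^ 2
      ≤ ∑ i ∈ range R, (1 / ((i : ℝ) + 1 / 2) - 1 / ((i : ℝ) + 3 / 2)) :=
        sum_le_sum fun i _ => key i
    _ = 2 - 1 / ((R : ℝ) + 1 / 2) := htel R
    _ ≤ 2 := by
        have : (0 : ℝ) ≤ 1 / ((R : ℝ) + 1 / 2) := by positivity
        linarith

/-- **Finite sums under a square power bound**: `Σ_{i<R} φ i ≤ 2C` if `φ i ≤ C/(i+1)²`.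
[folklore] -/
theorem sum_range_le_of_sq_bound {φ : ℕ → ℝ} {C : ℝ} (hC : 0 ≤ C)
    (h : ∀ i, φ i ≤ C / ((i : ℝ) + 1) ^ 2) (R : ℕ) : ∑ i ∈ range R, φ i ≤ 2 * C := by
  calc ∑ i ∈ range R, φ i ≤ ∑ i ∈ range R, C * (1 / ((i : ℝ) + 1) ^ 2) :=
        sum_le_sum fun i _ => (h i).trans (le_of_eq (by ring))
    _ = C * ∑ i ∈ range R, 1 / ((i : ℝ) + 1) ^ 2 := by rw [mul_sum]
    _ ≤ C * 2 := mul_le_mul_of_nonneg_left (sum_range_one_div_sq_le_two R) hC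
    _ = 2 * C := by ring

/-- **Tails under a power bound**: `Σ_{i<R, k<i} φ i ≤ 2C/(k+1)^p` if `φ i ≤ C/(i+1)^{p+2}`
(for `i > k`, `(i+1)^{p+2} ≥ (k+1)^p (i+1)²`). [folklore] -/
theorem sum_filter_lt_le_of_pow_bound {φ : ℕ → ℝ} {C : ℝ} (hC : 0 ≤ C) {p : ℕ}
    (h : ∀ i, φ i ≤ C / ((i : ℝ) + 1) ^ (p + 2)) (k R : ℕ) :
    ∑ i ∈ (range R).filter (fun i => k < i), φ i ≤ 2 * C / ((k : ℝ) + 1) ^ p := by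
  have hk1 : (0 : ℝ) < (k : ℝ) + 1 := by positivity
  have hkey : ∀ i, k < i → φ i ≤ C / ((k : ℝ) + 1) ^ p * (1 / ((i : ℝ) + 1) ^ 2) := by
    intro i hi
    refine (h i).trans ?_
    have hi1 : (0 : ℝ) < (i : ℝ) + 1 := by positivity
    have hki : (k : ℝ) + 1 ≤ (i : ℝ) + 1 := by
      have : (k : ℝ) ≤ i := by exact_mod_cast hi.le
      linarith
    rw [div_mul_div_comm, mul_one, div_le_div_iff₀ (pow_pos hi1 _) (by positivity), pow_add]
    have := pow_le_pow_left₀ hk1.le hki p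
    have hC' : 0 ≤ C * ((i : ℝ) + 1) ^ 2 := by positivity
    nlinarith
  calc ∑ i ∈ (range R).filter (fun i => k < i), φ i
      ≤ ∑ i ∈ (range R).filter (fun i => k < i), C / ((k : ℝ) + 1) ^ p * (1 / ((i : ℝ) + 1) ^ 2) :=
        sum_le_sum fun i hi => hkey i (mem_filter.mp hi).2
    _ = C / ((k : ℝ) + 1) ^ p * ∑ i ∈ (range R).filter (fun i => k < i), 1 / ((i : ℝ) + 1) ^ 2 := by
        rw [mul_sum]
    _ ≤ C / ((k : ℝ) + 1) ^ p * ∑ i ∈ range R, 1 / ((i : ℝ) + 1) ^ 2 :=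
        mul_le_mul_of_nonneg_left
          (sum_le_sum_of_subset_of_nonneg (filter_subset _ _) fun i _ _ => by positivity)
          (div_nonneg hC (pow_nonneg hk1.le _))
    _ ≤ C / ((k : ℝ) + 1) ^ p * 2 :=
        mul_le_mul_of_nonneg_left (sum_range_one_div_sq_le_two R)
          (div_nonneg hC (pow_nonneg hk1.le _))
    _ = 2 * C / ((k : ℝ) + 1) ^ p := by ring

/-- `(i + 1)(M − i + 1) ≥ M + 1` for `i ≤ M`. [folklore] -/
theorem succ_mul_sub_succ_ge {i M : ℕ} (hi : i ≤ M) :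
    (M : ℝ) + 1 ≤ ((i : ℝ) + 1) * (((M - i : ℕ) : ℝ) + 1) := by
  have h : ((M - i : ℕ) : ℝ) = (M : ℝ) - i := by rw [Nat.cast_sub hi]
  rw [h]
  have hi' : (i : ℝ) ≤ M := by exact_mod_cast hi
  have hi0 : (0 : ℝ) ≤ i := by positivity
  nlinarith

/-- **Convolutions under power bounds**: `Σ_{i ≤ M} f i g (M − i) ≤ A B / (M+1)^p` if
`f i ≤ A/(i+1)^{p+1}` and `0 ≤ g i ≤ B/(i+1)^{p+1}` (each of the `M + 1` terms is at most
`A B / ((i+1)(M−i+1))^{p+1} ≤ A B / (M+1)^{p+1}`). This controls `Σ_r f₁(r) Δ₀(L − r)` in MZ13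
Lemma 3 (arXiv:1109.1588 p. 12). [folklore] -/
theorem sum_mul_sub_le_of_pow_bound {f g : ℕ → ℝ} {A B : ℝ} (hA : 0 ≤ A) (hB : 0 ≤ B) {p : ℕ}
    (hg0 : ∀ i, 0 ≤ g i) (hf : ∀ i, f i ≤ A / ((i : ℝ) + 1) ^ (p + 1))
    (hg : ∀ i, g i ≤ B / ((i : ℝ) + 1) ^ (p + 1)) (M : ℕ) :
    ∑ i ∈ range (M + 1), f i * g (M - i) ≤ A * B / ((M : ℝ) + 1) ^ p := by
  have hM1 : (0 : ℝ) < (M : ℝ) + 1 := by positivity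
  have hterm : ∀ i ∈ range (M + 1), f i * g (M - i) ≤ A * B / ((M : ℝ) + 1) ^ (p + 1) := by
    intro i hi
    have hiM : i ≤ M := Nat.lt_succ_iff.mp (mem_range.mp hi)
    have hi1 : (0 : ℝ) < (i : ℝ) + 1 := by positivity
    have hj1 : (0 : ℝ) < ((M - i : ℕ) : ℝ) + 1 := by positivity
    calc f i * g (M - i) ≤ A / ((i : ℝ) + 1) ^ (p + 1) * (B / (((M - i : ℕ) : ℝ) + 1) ^ (p + 1)) :=
          mul_le_mul (hf i) (hg _) (hg0 _) (div_nonneg hA (pow_nonneg hi1.le _))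
      _ = A * B / (((i : ℝ) + 1) * (((M - i : ℕ) : ℝ) + 1)) ^ (p + 1) := by
          rw [mul_pow]; field_simp
      _ ≤ A * B / ((M : ℝ) + 1) ^ (p + 1) := by
          refine div_le_div_of_nonneg_left (mul_nonneg hA hB) (pow_pos hM1 _) ?_
          exact pow_le_pow_left₀ hM1.le (succ_mul_sub_succ_ge hiM) _
  calc ∑ i ∈ range (M + 1), f i * g (M - i)
      ≤ ∑ i ∈ range (M + 1), A * B / ((M : ℝ) + 1) ^ (p + 1) := sum_le_sum hterm
    _ = ((M : ℝ) + 1) * (A * B / ((M : ℝ) + 1) ^ (p + 1)) := by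
        rw [sum_const, card_range, nsmul_eq_mul]; push_cast; ring
    _ = A * B / ((M : ℝ) + 1) ^ p := by
        rw [pow_succ]; field_simp

/-- **Square roots under a power bound**: `√(a φ k) ≤ √(a C) / (k+1)^p` if `φ k ≤ C/(k+1)^{2p}`,
`a, C ≥ 0`. This controls the LTQO factor `√Δ₀(ℓ)` of MZ13 Corollary 2 / Lemma 4. [folklore] -/
theorem sqrt_le_of_pow_bound {φ : ℕ → ℝ} {C a : ℝ} (hC : 0 ≤ C) (ha : 0 ≤ a) {p : ℕ}
    (h : ∀ k, φ k ≤ C / ((k : ℝ) + 1) ^ (2 * p)) (k : ℕ) :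
    Real.sqrt (a * φ k) ≤ Real.sqrt (a * C) / ((k : ℝ) + 1) ^ p := by
  have hk1 : (0 : ℝ) < (k : ℝ) + 1 := by positivity
  have h1 : a * φ k ≤ (Real.sqrt (a * C) / ((k : ℝ) + 1) ^ p) ^ 2 := by
    rw [div_pow, Real.sq_sqrt (mul_nonneg ha hC), ← pow_mul, mul_comm p 2]
    calc a * φ k ≤ a * (C / ((k : ℝ) + 1) ^ (2 * p)) := mul_le_mul_of_nonneg_left (h k) ha
      _ = a * C / ((k : ℝ) + 1) ^ (2 * p) := by ring
  calc Real.sqrt (a * φ k) ≤ Real.sqrt ((Real.sqrt (a * C) / ((k : ℝ) + 1) ^ p) ^ 2) :=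
        Real.sqrt_le_sqrt h1
    _ = Real.sqrt (a * C) / ((k : ℝ) + 1) ^ p := Real.sqrt_sq (by positivity)

/-- **Half-index reparametrisation**: `1/((j − j/2) + 1)^p ≤ 2^p/(j+1)^p` (`j − j/2 + 1 ≥ (j+1)/2`).
[folklore] -/
theorem one_div_sub_half_succ_pow_le (j p : ℕ) :
    1 / (((j - j / 2 : ℕ) : ℝ) + 1) ^ p ≤ 2 ^ p / ((j : ℝ) + 1) ^ p := by
  have hj1 : (0 : ℝ) < (j : ℝ) + 1 := by positivity
  have h1 : (0 : ℝ) < ((j - j / 2 : ℕ) : ℝ) + 1 := by positivity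
  have hkey : (j : ℝ) + 1 ≤ 2 * (((j - j / 2 : ℕ) : ℝ) + 1) := by
    have h2 : j + 1 ≤ 2 * ((j - j / 2) + 1) := by omega
    exact_mod_cast h2
  rw [div_le_div_iff₀ (pow_pos h1 p) (pow_pos hj1 p), one_mul, ← mul_pow]
  exact pow_le_pow_left₀ hj1.le hkey p

/-- Half-index reparametrisation for `j / 2`: `1/((j/2) + 1)^p ≤ 2^p/(j+1)^p`. [folklore] -/
theorem one_div_half_succ_pow_le (j p : ℕ) :
    1 / (((j / 2 : ℕ) : ℝ) + 1) ^ p ≤ 2 ^ p / ((j : ℝ) + 1) ^ p := by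
  have hj1 : (0 : ℝ) < (j : ℝ) + 1 := by positivity
  have h1 : (0 : ℝ) < ((j / 2 : ℕ) : ℝ) + 1 := by positivity
  have hkey : (j : ℝ) + 1 ≤ 2 * (((j / 2 : ℕ) : ℝ) + 1) := by
    have h2 : j + 1 ≤ 2 * (j / 2 + 1) := by omega
    exact_mod_cast h2
  rw [div_le_div_iff₀ (pow_pos h1 p) (pow_pos hj1 p), one_mul, ← mul_pow]
  exact pow_le_pow_left₀ hj1.le hkey p

/-- Half-index reparametrisation for `(L − 1)/2`: `1/(((L−1)/2) + 1)^p ≤ 2^p/(L+1)^p`… in the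
weaker but sufficient form `≤ 4^p/(L+1)^p` (`(L−1)/2 + 1 ≥ (L+1)/4` for all `L`). [folklore] -/
theorem one_div_half_pred_succ_pow_le (L p : ℕ) :
    1 / ((((L - 1) / 2 : ℕ) : ℝ) + 1) ^ p ≤ 4 ^ p / ((L : ℝ) + 1) ^ p := by
  have hL1 : (0 : ℝ) < (L : ℝ) + 1 := by positivity
  have h1 : (0 : ℝ) < (((L - 1) / 2 : ℕ) : ℝ) + 1 := by positivity
  have hkey : (L : ℝ) + 1 ≤ 4 * ((((L - 1) / 2 : ℕ) : ℝ) + 1) := by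
    have h2 : L + 1 ≤ 4 * ((L - 1) / 2 + 1) := by omega
    exact_mod_cast h2
  rw [div_le_div_iff₀ (pow_pos h1 p) (pow_pos hL1 p), one_mul, ← mul_pow]
  exact pow_le_pow_left₀ hL1.le hkey p

/-- Polynomial weights against a power bound are summable in the crude form used for the
constant `c` of MZ13 Proposition 2: `Σ_{j<R} (j+1)^a · (C/(j+1)^{a+2}) ≤ 2C`. [folklore] -/
theorem sum_pow_mul_pow_bound_le {C : ℝ} (hC : 0 ≤ C) (a R : ℕ) :
    ∑ j ∈ range R, ((j : ℝ) + 1) ^ a * (C / ((j : ℝ) + 1) ^ (a + 2)) ≤ 2 * C := by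
  have h : ∀ j : ℕ, ((j : ℝ) + 1) ^ a * (C / ((j : ℝ) + 1) ^ (a + 2)) = C / ((j : ℝ) + 1) ^ 2 := by
    intro j
    have hj1 : (0 : ℝ) < (j : ℝ) + 1 := by positivity
    rw [pow_add]
    field_simp
  simp_rw [h]
  exact sum_range_le_of_sq_bound hC (fun i => le_rfl) R

end Literature.MathematicalPhysics.QuantumLattice
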